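import Summits.ValiantsHypothesis.ValiantsHypothesis.Theorems.LacunarySymmetroidMatrixDescartesCensusDoorA34IsotropicTangent
import Summits.ValiantsHypothesis.ValiantsHypothesis.Theorems.LacunarySymmetroidMatrixDescartesCensusSpanRankDiagonal

/-!
# `MatrixDescartes` census — DOOR A at `(3,4)`: the COMMON-EIGENVECTOR PARITY LAW — a Descartes deficiency `Z₊ ≤ 18` for `(3,4)` pencils three of
# whose letters share an eigenvector with DEFINITE complementary `2 × 2` blocks (all supports passing the tangent parity test)

HONEST FRAMING.  Object-search cell `pub-symmetroid`, door-A seat `val-sym-door-p3` (g14); helper file beside the OPEN typed statement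
`DoorA34 = PosRootLawAt 3 4 18` (route item `Theses.LacunarySymmetroid.DoorA34`, stmt-ValiantsHypothesis-19980), asserted nowhere.  Third instance of
the EDGE-EXACTNESS mechanism of `…IsotropicTangent` (tangent pencils) and `…DiagonalTriple` (diagonal triples).

THE FAMILY.  Three of the four letters, `S_i, S_j, S_k` (indices `≠ m`), have the block form `[[p,q,0],[q,r,0],[0,0,λ]]` — a COMMON EIGENVECTOR
`e₂` (any common eigenvector after one congruence, `card_posRoots_commonEig_congr_le_18`) — with DEFINITE complementary blocks `pr − q² > 0`
(positive or negative definite, independently per letter; `λ` of any sign, so every inertia incl. the word `IIII` occurs); `S_m` is an arbitrary real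
`3 × 3` matrix.  All `20` triple-sum monomials are present generically.  (Diagonal triples with definite `2 × 2` corners are the intersection with
`…DiagonalTriple`; here the blocks need not commute.)

THE LAW (kernel-checked, every support):
* `twoByTwo_mixed_pos`, `twoByTwo_disc_nonneg` — for two definite symmetric `2 × 2` blocks `B_a, B_b`: the mixed term
  `M = tr(adj B_a · B_b) = p_a r_b − 2 q_a q_b + r_a p_b` has the sign of `p_a p_b` and `M² ≥ 4 det B_a det B_b` (the pencil `B_a + sB_b` is hyperbolic;
  explicit sum-of-squares certificate);
* `det_blockLetter`, `trace_adjugate_blockLetters` — the face block is `(Σ λ_l y_l) · det(Σ y_l B_l)`: on the edge `{a,b}` the four coefficients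
  are those of the REAL-ROOTED cubic `(λ_a + λ_b s)(det B_a + M s + det B_b s²)`;
* `blockLin_sign_of_parities` — DESCARTES IS EXACT there: the edge has `≥ 2` alternations iff `M < 0` iff the two blocks have OPPOSITE definiteness
  (`p_a p_b < 0`), and `≤ 1` iff `p_a p_b > 0`;
* `block_edge_sign`, **`card_posRoots_commonEig_le_18`** — for a nineteen the alternation count on each edge is a function of `d` (ranks in the
  triple-sum table, `…FullAlternation`), so the TANGENT PARITY TEST of `…IsotropicTangent` (`Odd (τ_ij + τ_ik + τ_jk)`, `τ_ab = [≥ 2 alternations]`)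
  forces `(p_ip_j)(p_ip_k)(p_jp_k) < 0`, impossible: **`Z₊ ≤ 18`** on every support passing the test (920/1088/1088/920 of the 2060 sorted
  3-Sidon supports `d₃ ≤ 30` for `m = 0/1/2/3`, seat script `parity.py`); instances by `decide`: `…_on_0_1_4_13` (`m = 0`), `…_on_0_1_7_11` (`m = 0`).

Nothing here bounds `ζ_sym(3,4)` (`∈ {18,19}` unchanged) or `DoorA34`; nothing bears on `MatrixDescartes` (stmt-ValiantsHypothesis-18050) or on
`VP ≠ VNP` — VP≠VNP not moved.

[folklore] Descartes' rule of signs is exact for real-rooted polynomials; hyperbolicity of a `2 × 2` symmetric pencil with a definite member; elementary.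
-/

-- `Summit.ValiantsHypothesis.ValiantsHypothesis.…` repeats a component by the D-0017 layout
-- (single-conjunct summit), which the `dupNamespace` linter flags; the name is mandated.
set_option linter.dupNamespace false

namespace Summit.ValiantsHypothesis.ValiantsHypothesis.Theorems.LacunarySymmetroidMatrixDescartes.Census

open Polynomial Finset
open scoped BigOperators Polynomial Matrix
open Summit.ValiantsHypothesis.ValiantsHypothesis.Theorems.LacunarySymmetroidMatrixDescartes.Census.SignSplit (pencil posRootCount)

/-! ## 1. Two definite `2 × 2` blocks -/

/-- **Sign of the mixed term.**  For definite `B_a = [[p_a,q_a],[q_a,r_a]]`, `B_b` (`det > 0`): `p_a p_b · (p_a r_b − 2 q_a q_b + r_a p_b) > 0`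
(`p_a·M = B_b[(−q_a, p_a)] + det B_a · p_b`). [folklore] -/
theorem twoByTwo_mixed_pos {pa qa ra pb qb rb : ℝ} (hDa : 0 < pa * ra - qa ^ 2) (hDb : 0 < pb * rb - qb ^ 2) :
    0 < (pa * pb) * (pa * rb - 2 * qa * qb + ra * pb) := by
  have hpa : pa ≠ 0 := by rintro rfl; nlinarith [sq_nonneg qa]
  have hpb : pb ≠ 0 := by rintro rfl; nlinarith [sq_nonneg qb]
  -- pa·pb·M·pb² = pb² · (pb·B_b[(−qa, pa)] + det B_a · pb²),  pb·B_b[(x,y)] = (pb x + qb y)² + det B_b · y²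
  have hsign : 0 < (pa * pb) * (pa * rb - 2 * qa * qb + ra * pb) * pb * pb := by
    have e : (pa * pb) * (pa * rb - 2 * qa * qb + ra * pb) * pb * pb
        = (((pb * (-qa) + qb * pa) ^ 2 + (pb * rb - qb ^ 2) * pa ^ 2) + (pa * ra - qa ^ 2) * pb ^ 2) * pb ^ 2 := by ring
    rw [e]; positivity
  have hpb2 : 0 < pb * pb := mul_self_pos.mpr hpb
  have : 0 < (pa * pb) * (pa * rb - 2 * qa * qb + ra * pb) * (pb * pb) := by rw [← mul_assoc]; exact hsign
  exact (pos_iff_pos_of_mul_pos this).mpr hpb2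

/-- **Hyperbolicity of the `2 × 2` pencil** (sum-of-squares certificate): `p_a² (M² − 4 det B_a det B_b) = (p_a(p_a r_b − r_a p_b) − 2q_a(p_a q_b − q_a p_b))²
+ 4 det B_a (p_a q_b − q_a p_b)²`, hence `M² ≥ 4 det B_a det B_b` when `det B_a > 0`. [folklore] -/
theorem twoByTwo_disc_nonneg {pa qa ra pb qb rb : ℝ} (hDa : 0 < pa * ra - qa ^ 2) :
    4 * ((pa * ra - qa ^ 2) * (pb * rb - qb ^ 2)) ≤ (pa * rb - 2 * qa * qb + ra * pb) ^ 2 := by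
  have hpa : pa ≠ 0 := by rintro rfl; nlinarith [sq_nonneg qa]
  have hpa2 : 0 < pa ^ 2 := by positivity
  have key : pa ^ 2 * ((pa * rb - 2 * qa * qb + ra * pb) ^ 2 - 4 * ((pa * ra - qa ^ 2) * (pb * rb - qb ^ 2)))
      = (pa * (pa * rb - ra * pb) - 2 * qa * (pa * qb - qa * pb)) ^ 2 + 4 * (pa * ra - qa ^ 2) * (pa * qb - qa * pb) ^ 2 := by ring
  have hnn : 0 ≤ pa ^ 2 * ((pa * rb - 2 * qa * qb + ra * pb) ^ 2 - 4 * ((pa * ra - qa ^ 2) * (pb * rb - qb ^ 2))) := by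
    rw [key]; positivity
  nlinarith [le_of_mul_le_mul_left (by linarith [hnn] : pa ^ 2 * 0 ≤ pa ^ 2 * ((pa * rb - 2 * qa * qb + ra * pb) ^ 2
    - 4 * ((pa * ra - qa ^ 2) * (pb * rb - qb ^ 2)))) hpa2]

/-! ## 2. Descartes is exact for `(λ_a + λ_b s)(D_a + M s + D_b s²)` with a hyperbolic quadratic factor -/

/-- **Sign law for the block edge cubic (parity form).**  Let `c₀ = λ_a D_a, c₁ = λ_b D_a + λ_a M, c₂ = λ_b M + λ_a D_b, c₃ = λ_b D_b` with
`D_a, D_b > 0`, `M² ≥ 4 D_a D_b`, `λ_a λ_b ≠ 0`, `M ≠ 0`, and let the adjacent products have signs `(−1)^{s₁}, (−1)^{s₂}, (−1)^{s₃}`.  Then at least two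
`sₖ` are odd iff `M < 0` (and at most one iff `M > 0`): the count of alternations is `[λ_aλ_b < 0] + 2[M < 0]` exactly. [folklore] -/
theorem blockLin_sign_of_parities {la lb Da Db M c₀ c₁ c₂ c₃ : ℝ} {s₁ s₂ s₃ : ℕ}
    (hDa : 0 < Da) (hDb : 0 < Db) (hM2 : 4 * (Da * Db) ≤ M ^ 2) (hla : la ≠ 0) (hlb : lb ≠ 0) (hM : M ≠ 0)
    (hc₀ : c₀ = la * Da) (hc₁ : c₁ = lb * Da + la * M) (hc₂ : c₂ = lb * M + la * Db) (hc₃ : c₃ = lb * Db)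
    (h₁ : 0 < (-1 : ℝ) ^ s₁ * (c₀ * c₁)) (h₂ : 0 < (-1 : ℝ) ^ s₂ * (c₁ * c₂)) (h₃ : 0 < (-1 : ℝ) ^ s₃ * (c₂ * c₃)) :
    (2 ≤ s₁ % 2 + s₂ % 2 + s₃ % 2 → M < 0) ∧ (s₁ % 2 + s₂ % 2 + s₃ % 2 ≤ 1 → 0 < M) := by
  subst hc₀ hc₁ hc₂ hc₃
  have odd_of_neg : ∀ {s : ℕ} {x : ℝ}, 0 < (-1 : ℝ) ^ s * x → x < 0 → s % 2 = 1 := fun {s x} hx hneg => by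
    rcases Nat.mod_two_eq_zero_or_one s with h | h
    · rw [(Nat.even_iff.mpr h).neg_one_pow] at hx; linarith
    · exact h
  have even_of_pos : ∀ {s : ℕ} {x : ℝ}, 0 < (-1 : ℝ) ^ s * x → 0 < x → s % 2 = 0 := fun {s x} hx hpos => by
    rcases Nat.mod_two_eq_zero_or_one s with h | h
    · exact h
    · rw [(Nat.odd_iff.mpr h).neg_one_pow] at hx; linarith
  have neg_of_odd : ∀ {s : ℕ} {x : ℝ}, 0 < (-1 : ℝ) ^ s * x → s % 2 = 1 → x < 0 := fun {s x} hx hs => by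
    rw [(Nat.odd_iff.mpr hs).neg_one_pow] at hx; linarith
  have pos_of_even : ∀ {s : ℕ} {x : ℝ}, 0 < (-1 : ℝ) ^ s * x → s % 2 = 0 → 0 < x := fun {s x} hx hs => by
    rw [(Nat.even_iff.mpr hs).neg_one_pow] at hx; linarith
  have hla2 : 0 < la ^ 2 := by positivity
  have hlb2 : 0 < lb ^ 2 := by positivity
  -- total parity: (-1)^(s₁+s₂+s₃) has the sign of c₀ c₃ = λaλb DaDb
  have hc1 : lb * Da + la * M ≠ 0 := by rintro h; rw [h] at h₁; simp at h₁
  have hc2 : lb * M + la * Db ≠ 0 := by rintro h; rw [h] at h₃; simp at h₃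
  have htot : 0 < (-1 : ℝ) ^ (s₁ + s₂ + s₃) * ((la * lb) * (Da * Db)) := by
    have hp := mul_pos (mul_pos h₁ h₂) h₃
    have e : (-1 : ℝ) ^ s₁ * (la * Da * (lb * Da + la * M)) * ((-1) ^ s₂ * ((lb * Da + la * M) * (lb * M + la * Db)))
        * ((-1) ^ s₃ * ((lb * M + la * Db) * (lb * Db)))
        = ((-1 : ℝ) ^ (s₁ + s₂ + s₃) * ((la * lb) * (Da * Db))) * ((lb * Da + la * M) ^ 2 * (lb * M + la * Db) ^ 2) := by
      rw [pow_add, pow_add]; ring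
    rw [e] at hp
    exact (pos_iff_pos_of_mul_pos hp).mpr (by positivity)
  obtain ⟨m1, m2, m3⟩ := And.intro (Nat.mod_two_eq_zero_or_one s₁) (And.intro (Nat.mod_two_eq_zero_or_one s₂) (Nat.mod_two_eq_zero_or_one s₃))
  rcases lt_or_gt_of_ne (mul_ne_zero hla hlb) with hl | hl <;> rcases lt_or_gt_of_ne hM with hm | hm
  · -- λλ < 0, M < 0 : three alternations
    have q1 : la * Da * (lb * Da + la * M) < 0 := by nlinarith [mul_pos hDa hDa, mul_pos hla2 hDa]
    have q3 : (lb * M + la * Db) * (lb * Db) < 0 := by nlinarith [mul_pos hDb hDb, mul_pos hlb2 hDb]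
    have q2 : (lb * Da + la * M) * (lb * M + la * Db) < 0 := by
      nlinarith [mul_pos hlb2 hDa, mul_pos hla2 hDb, mul_pos hDa hDb, sq_nonneg M]
    have := odd_of_neg h₁ q1; have := odd_of_neg h₂ q2; have := odd_of_neg h₃ q3
    exact ⟨fun _ => hm, fun h => by omega⟩
  · -- λλ < 0, M > 0 : exactly one alternation
    have hpar : (s₁ + s₂ + s₃) % 2 = 1 := odd_of_neg htot (by nlinarith [mul_pos hDa hDb])
    have hnot : ¬ (la * Da * (lb * Da + la * M) < 0 ∧ (lb * M + la * Db) * (lb * Db) < 0) := by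
      rintro ⟨k1, k2⟩
      -- λa² M < (−λaλb) Da and λb² M < (−λaλb) Db
      have k1' : la ^ 2 * M < -(la * lb) * Da := by nlinarith
      have k2' : lb ^ 2 * M < -(la * lb) * Db := by nlinarith
      have kk := mul_lt_mul'' k1' k2' (by positivity) (by positivity)
      nlinarith [kk, mul_pos hla2 hlb2]
    refine ⟨fun h => ?_, fun _ => hm⟩
    exfalso
    rcases m1 with a | a <;> rcases m2 with b | b <;> rcases m3 with c | c <;> simp only [a, b, c] at h hpar <;> try omega
    all_goals exact hnot ⟨neg_of_odd h₁ a, neg_of_odd h₃ c⟩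
  · -- λλ > 0, M < 0 : exactly two alternations
    have hpar : (s₁ + s₂ + s₃) % 2 = 0 := even_of_pos htot (by nlinarith [mul_pos hDa hDb])
    have hnot : ¬ (0 < la * Da * (lb * Da + la * M) ∧ 0 < (lb * M + la * Db) * (lb * Db)) := by
      rintro ⟨k1, k2⟩
      have k1' : la ^ 2 * (-M) < (la * lb) * Da := by nlinarith
      have k2' : lb ^ 2 * (-M) < (la * lb) * Db := by nlinarith
      have kk := mul_lt_mul'' k1' k2' (by nlinarith) (by nlinarith)
      nlinarith [kk, mul_pos hla2 hlb2]
    refine ⟨fun _ => hm, fun h => ?_⟩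
    exfalso
    rcases m1 with a | a <;> rcases m2 with b | b <;> rcases m3 with c | c <;> simp only [a, b, c] at h hpar <;> try omega
    all_goals exact hnot ⟨pos_of_even h₁ a, pos_of_even h₃ c⟩
  · -- λλ > 0, M > 0 : no alternation
    have q1 : 0 < la * Da * (lb * Da + la * M) := by nlinarith [mul_pos hDa hDa, mul_pos hla2 hDa]
    have q3 : 0 < (lb * M + la * Db) * (lb * Db) := by nlinarith [mul_pos hDb hDb, mul_pos hlb2 hDb]
    have q2 : 0 < (lb * Da + la * M) * (lb * M + la * Db) := by
      nlinarith [mul_pos hlb2 hDa, mul_pos hla2 hDb, mul_pos hDa hDb, sq_nonneg M]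
    have := even_of_pos h₁ q1; have := even_of_pos h₂ q2; have := even_of_pos h₃ q3
    exact ⟨fun h => by omega, fun _ => hm⟩

/-! ## 3. Block letters: the face block is `(Σ λ_l y_l) · det(Σ y_l B_l)` -/

/-- **Determinant of a block letter** `[[p,q,0],[q',r,0],[0,0,λ]]`: `λ·(pr − q q')`. [folklore] -/
theorem det_blockLetter (S : Matrix (Fin 3) (Fin 3) ℝ) (h02 : S 0 2 = 0) (h12 : S 1 2 = 0) (h20 : S 2 0 = 0) (h21 : S 2 1 = 0) :
    S.det = S 2 2 * (S 0 0 * S 1 1 - S 0 1 * S 1 0) := by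
  rw [Matrix.det_fin_three, h02, h12, h20, h21]; ring

/-- **Polarised determinant of two block letters**: `tr(adj S_a · S_b) = λ_b det B_a + λ_a · (p_a r_b − q_a q_b' − q_a' q_b + r_a p_b)`. [folklore] -/
theorem trace_adjugate_blockLetters (S T : Matrix (Fin 3) (Fin 3) ℝ)
    (h02 : S 0 2 = 0) (h12 : S 1 2 = 0) (h20 : S 2 0 = 0) (h21 : S 2 1 = 0)
    (k02 : T 0 2 = 0) (k12 : T 1 2 = 0) (k20 : T 2 0 = 0) (k21 : T 2 1 = 0) :
    (S.adjugate * T).trace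
      = T 2 2 * (S 0 0 * S 1 1 - S 0 1 * S 1 0) + S 2 2 * (S 0 0 * T 1 1 - S 0 1 * T 1 0 - S 1 0 * T 0 1 + S 1 1 * T 0 0) := by
  simp only [Matrix.trace_fin_three, Matrix.mul_apply, Fin.sum_univ_three, Matrix.adjugate_fin_three, Matrix.of_apply,
    Matrix.cons_val', Matrix.cons_val_zero, Matrix.cons_val_one, Matrix.cons_val_two, Matrix.empty_val',
    Matrix.cons_val_fin_one, Matrix.head_cons, Matrix.tail_cons, Matrix.head_fin_const, h02, h12, h20, h21, k02, k12, k20, k21]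
  ring

/-! ## 4. A nineteen with two block letters: the edge test reads the relative definiteness -/

/-- **Edge sign law for a block nineteen.**  Letters `S_i, S_j` symmetric block letters (`e₂` a common eigenvector) with DEFINITE `2 × 2` blocks;
`19` positive det-roots; `ρ` the rank function of the triple-sum table.  If at least two of the three adjacent rank-sums on the edge `{i,j}` are odd
then `(S_i)₀₀ (S_j)₀₀ < 0` (opposite definiteness), if at most one then `(S_i)₀₀ (S_j)₀₀ > 0`. [folklore] -/
theorem block_edge_sign (d : Fin 4 → ℕ) (S : Fin 4 → Matrix (Fin 3) (Fin 3) ℝ) {i j : Fin 4} (hij : i ≠ j)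
    (hi : S i 0 2 = 0 ∧ S i 1 2 = 0 ∧ S i 2 0 = 0 ∧ S i 2 1 = 0 ∧ S i 1 0 = S i 0 1)
    (hj : S j 0 2 = 0 ∧ S j 1 2 = 0 ∧ S j 2 0 = 0 ∧ S j 2 1 = 0 ∧ S j 1 0 = S j 0 1)
    (hdi : 0 < S i 0 0 * S i 1 1 - S i 0 1 ^ 2) (hdj : 0 < S j 0 0 * S j 1 1 - S j 0 1 ^ 2)
    (h19 : 19 ≤ ((Matrix.det (∑ l, ((X : ℝ[X]) ^ d l) • (S l).map C)).roots.toFinset.filter (fun t => 0 < t)).card)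
    (ρ : ℕ → ℕ) (hρ : ∀ e, ρ e = (((Finset.univ : Finset (Fin 4 × Fin 4 × Fin 4)).image
      (fun p => d p.1 + d p.2.1 + d p.2.2)).filter (· < e)).card) :
    (2 ≤ (ρ (3 * d i) + ρ (2 * d i + d j)) % 2 + (ρ (2 * d i + d j) + ρ (2 * d j + d i)) % 2
        + (ρ (2 * d j + d i) + ρ (3 * d j)) % 2 → S i 0 0 * S j 0 0 < 0) ∧
    ((ρ (3 * d i) + ρ (2 * d i + d j)) % 2 + (ρ (2 * d i + d j) + ρ (2 * d j + d i)) % 2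
        + (ρ (2 * d j + d i) + ρ (3 * d j)) % 2 ≤ 1 → 0 < S i 0 0 * S j 0 0) := by
  classical
  obtain ⟨hi02, hi12, hi20, hi21, his⟩ := hi
  obtain ⟨hj02, hj12, hj20, hj21, hjs⟩ := hj
  set P : ℝ[X] := (∑ l, (X : ℝ[X]) ^ d l • (S l).map C).det with hPdef
  have hP0 : P ≠ 0 := fun h0 => by
    rw [h0, Polynomial.roots_zero, Multiset.toFinset_zero, Finset.filter_empty, Finset.card_empty] at h19; omega
  set T : Finset ℕ := (Finset.univ : Finset (Fin 4 × Fin 4 × Fin 4)).image (fun p => d p.1 + d p.2.1 + d p.2.2) with hTdef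
  have hT20 : T.card ≤ 20 := card_tripleSums_le_of_collapse d id (fun _ => rfl) (by decide)
  have hsum3 : (Finset.univ : Finset (Fin 3 → Fin 4)).image (fun g => ∑ t, d (g t)) = T := sumset_three_eq_tripleSums d
  have hZ : ((Finset.univ : Finset (Fin 3 → Fin 4)).image (fun g => ∑ t, d (g t))).card
      ≤ (P.roots.toFinset.filter (fun t => 0 < t)).card + 1 := by rw [hsum3]; omega
  have hsupp : P.support = T := by rw [← hsum3]; exact support_det_pencil_eq_sumset_of_sharp d S hP0 hZ
  have hZ' : P.support.card ≤ (P.roots.toFinset.filter (fun t => 0 < t)).card + 1 := by rw [hsupp]; omega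
  have memT : ∀ a b c : Fin 4, d a + d b + d c ∈ P.support := fun a b c => by
    rw [hsupp, hTdef]; exact Finset.mem_image.mpr ⟨(a, b, c), Finset.mem_univ _, rfl⟩
  have hrank : ∀ e, (P.support.filter (· < e)).card = ρ e := fun e => by rw [hρ, hsupp]
  -- the letter determinants are non-zero: λ's are non-zero
  have hdetI := det_letter_ne_zero_of_nineteen d S h19 i; have hdetJ := det_letter_ne_zero_of_nineteen d S h19 j
  rw [det_blockLetter _ hi02 hi12 hi20 hi21, his] at hdetI; rw [det_blockLetter _ hj02 hj12 hj20 hj21, hjs] at hdetJ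
  have hli : S i 2 2 ≠ 0 := (mul_ne_zero_iff.mp hdetI).1
  have hlj : S j 2 2 ≠ 0 := (mul_ne_zero_iff.mp hdetJ).1
  -- the four edge coefficients
  have hc0 : P.coeff (3 * d i) = S i 2 2 * (S i 0 0 * S i 1 1 - S i 0 1 ^ 2) := by
    rw [hPdef, coeff_det_pencil_three_mul d S i (cube_unique_of_nineteen d S h19 i), det_blockLetter _ hi02 hi12 hi20 hi21, his]; ring
  have hc3 : P.coeff (3 * d j) = S j 2 2 * (S j 0 0 * S j 1 1 - S j 0 1 ^ 2) := by
    rw [hPdef, coeff_det_pencil_three_mul d S j (cube_unique_of_nineteen d S h19 j), det_blockLetter _ hj02 hj12 hj20 hj21, hjs]; ring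
  have hc1 : P.coeff (2 * d i + d j) = S j 2 2 * (S i 0 0 * S i 1 1 - S i 0 1 ^ 2)
      + S i 2 2 * (S i 0 0 * S j 1 1 - 2 * S i 0 1 * S j 0 1 + S i 1 1 * S j 0 0) := by
    rw [hPdef, coeff_det_pencil_three_square d S hij (square_unique_of_nineteen d S h19 hij),
      trace_adjugate_blockLetters _ _ hi02 hi12 hi20 hi21 hj02 hj12 hj20 hj21, his, hjs]; ring
  have hc2 : P.coeff (2 * d j + d i) = S j 2 2 * (S i 0 0 * S j 1 1 - 2 * S i 0 1 * S j 0 1 + S i 1 1 * S j 0 0)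
      + S i 2 2 * (S j 0 0 * S j 1 1 - S j 0 1 ^ 2) := by
    rw [hPdef, coeff_det_pencil_three_square d S hij.symm (square_unique_of_nineteen d S h19 hij.symm),
      trace_adjugate_blockLetters _ _ hj02 hj12 hj20 hj21 hi02 hi12 hi20 hi21, his, hjs]; ring
  have m0 : 3 * d i ∈ P.support := by rw [show 3 * d i = d i + d i + d i by ring]; exact memT i i i
  have m3 : 3 * d j ∈ P.support := by rw [show 3 * d j = d j + d j + d j by ring]; exact memT j j j
  have m1 : 2 * d i + d j ∈ P.support := by rw [show 2 * d i + d j = d i + d i + d j by ring]; exact memT i i j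
  have m2 : 2 * d j + d i ∈ P.support := by rw [show 2 * d j + d i = d j + d j + d i by ring]; exact memT j j i
  have r1 := pow_rank_mul_coeff_mul_coeff_pos_of_sharp P hZ' m0 m1; have r2 := pow_rank_mul_coeff_mul_coeff_pos_of_sharp P hZ' m1 m2
  have r3 := pow_rank_mul_coeff_mul_coeff_pos_of_sharp P hZ' m2 m3
  rw [hrank, hrank] at r1 r2 r3
  have hmix := twoByTwo_mixed_pos hdi hdj
  have hM : S i 0 0 * S j 1 1 - 2 * S i 0 1 * S j 0 1 + S i 1 1 * S j 0 0 ≠ 0 := (mul_ne_zero_iff.mp hmix.ne').2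
  have key := blockLin_sign_of_parities (la := S i 2 2) (lb := S j 2 2) hdi hdj (twoByTwo_disc_nonneg hdi) hli hlj hM
    hc0 hc1 hc2 hc3 r1 r2 r3
  refine ⟨fun h => ?_, fun h => ?_⟩
  · have := key.1 h; by_contra hcon; push Not at hcon
    exact absurd hmix (not_lt.mpr (mul_nonpos_of_nonneg_of_nonpos hcon this.le))
  · have := key.2 h; by_contra hcon; push Not at hcon
    exact absurd hmix (not_lt.mpr (mul_nonpos_of_nonpos_of_nonneg hcon this.le))

/-! ## 5. The parity law -/

/-- **COMMON-EIGENVECTOR PARITY LAW (all supports).**  Let a real `3 × 3` four-letter lacunary pencil have, for the three indices `l ≠ m`, symmetric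
block letters `[[p_l,q_l,0],[q_l,r_l,0],[0,0,λ_l]]` with DEFINITE blocks `p_l r_l − q_l² > 0` (`S_m` arbitrary).  With `ρ` the rank function of the
triple-sum table of `d` and `τ_ab = 1` iff at least two of the three adjacent rank-sums on the edge `{a,b}` are odd: if `τ_ij + τ_ik + τ_jk` is ODD,
the determinant has at most `18` distinct positive roots. [folklore] -/
theorem card_posRoots_commonEig_le_18 (d : Fin 4 → ℕ) (S : Fin 4 → Matrix (Fin 3) (Fin 3) ℝ) (m i j k : Fin 4)
    (him : i ≠ m) (hjm : j ≠ m) (hkm : k ≠ m) (hij : i ≠ j) (hik : i ≠ k) (hjk : j ≠ k)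
    (hblock : ∀ l, l ≠ m → S l 0 2 = 0 ∧ S l 1 2 = 0 ∧ S l 2 0 = 0 ∧ S l 2 1 = 0 ∧ S l 1 0 = S l 0 1)
    (hdef : ∀ l, l ≠ m → 0 < S l 0 0 * S l 1 1 - S l 0 1 ^ 2)
    (ρ : ℕ → ℕ) (hρ : ∀ e, ρ e = (((Finset.univ : Finset (Fin 4 × Fin 4 × Fin 4)).image
      (fun p => d p.1 + d p.2.1 + d p.2.2)).filter (· < e)).card)
    (hpar : Odd (
        (if 2 ≤ (ρ (3 * d i) + ρ (2 * d i + d j)) % 2 + (ρ (2 * d i + d j) + ρ (2 * d j + d i)) % 2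
              + (ρ (2 * d j + d i) + ρ (3 * d j)) % 2 then 1 else 0)
      + (if 2 ≤ (ρ (3 * d i) + ρ (2 * d i + d k)) % 2 + (ρ (2 * d i + d k) + ρ (2 * d k + d i)) % 2
              + (ρ (2 * d k + d i) + ρ (3 * d k)) % 2 then 1 else 0)
      + (if 2 ≤ (ρ (3 * d j) + ρ (2 * d j + d k)) % 2 + (ρ (2 * d j + d k) + ρ (2 * d k + d j)) % 2
              + (ρ (2 * d k + d j) + ρ (3 * d k)) % 2 then 1 else 0))) :
    ((Matrix.det (∑ l, ((X : ℝ[X]) ^ d l) • (S l).map C)).roots.toFinset.filter (fun t => 0 < t)).card ≤ 18 := by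
  by_contra hlt; push Not at hlt
  have h19 : 19 ≤ ((Matrix.det (∑ l, ((X : ℝ[X]) ^ d l) • (S l).map C)).roots.toFinset.filter (fun t => 0 < t)).card := by omega
  obtain ⟨nij, pij⟩ := block_edge_sign d S hij (hblock i him) (hblock j hjm) (hdef i him) (hdef j hjm) h19 ρ hρ
  obtain ⟨⟨nik, pik⟩, ⟨njk, pjk⟩⟩ := And.intro
    (block_edge_sign d S hik (hblock i him) (hblock k hkm) (hdef i him) (hdef k hkm) h19 ρ hρ)
    (block_edge_sign d S hjk (hblock j hjm) (hblock k hkm) (hdef j hjm) (hdef k hkm) h19 ρ hρ)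
  have hsq : 0 ≤ (S i 0 0 * S j 0 0) * (S i 0 0 * S k 0 0) * (S j 0 0 * S k 0 0) := by
    rw [show (S i 0 0 * S j 0 0) * (S i 0 0 * S k 0 0) * (S j 0 0 * S k 0 0) = (S i 0 0 * S j 0 0 * S k 0 0) ^ 2 by ring]; positivity
  split_ifs at hpar with h1 h2 h3 h3 h2 h3 h3
  · nlinarith [mul_pos_of_neg_of_neg (nij h1) (nik h2), njk h3]
  · exact absurd hpar (by decide)
  · exact absurd hpar (by decide)
  · push Not at h2 h3; nlinarith [mul_pos (pik (by omega)) (pjk (by omega)), nij h1]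
  · exact absurd hpar (by decide)
  · push Not at h1 h3; nlinarith [mul_pos (pij (by omega)) (pjk (by omega)), nik h2]
  · push Not at h1 h2; nlinarith [mul_pos (pij (by omega)) (pik (by omega)), njk h3]
  · exact absurd hpar (by decide)

/-- **Congruence form.**  The same conclusion for letters `Pᵀ D_l P` with ONE invertible real `P` and `D_l` (`l ≠ m`) symmetric block letters with
definite blocks — three letters with a COMMON EIGENVECTOR (the vector `P⁻¹e₂`) whose complementary blocks are definite; the count is a congruence
invariant (`…SpanRankDiagonal.posRootCount_congr`). [folklore] -/
theorem card_posRoots_commonEig_congr_le_18 (d : Fin 4 → ℕ) (D : Fin 4 → Matrix (Fin 3) (Fin 3) ℝ) (P : Matrix (Fin 3) (Fin 3) ℝ)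
    (hP : P.det ≠ 0) (m i j k : Fin 4)
    (him : i ≠ m) (hjm : j ≠ m) (hkm : k ≠ m) (hij : i ≠ j) (hik : i ≠ k) (hjk : j ≠ k)
    (hblock : ∀ l, l ≠ m → D l 0 2 = 0 ∧ D l 1 2 = 0 ∧ D l 2 0 = 0 ∧ D l 2 1 = 0 ∧ D l 1 0 = D l 0 1)
    (hdef : ∀ l, l ≠ m → 0 < D l 0 0 * D l 1 1 - D l 0 1 ^ 2)
    (ρ : ℕ → ℕ) (hρ : ∀ e, ρ e = (((Finset.univ : Finset (Fin 4 × Fin 4 × Fin 4)).image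
      (fun p => d p.1 + d p.2.1 + d p.2.2)).filter (· < e)).card)
    (hpar : Odd (
        (if 2 ≤ (ρ (3 * d i) + ρ (2 * d i + d j)) % 2 + (ρ (2 * d i + d j) + ρ (2 * d j + d i)) % 2
              + (ρ (2 * d j + d i) + ρ (3 * d j)) % 2 then 1 else 0)
      + (if 2 ≤ (ρ (3 * d i) + ρ (2 * d i + d k)) % 2 + (ρ (2 * d i + d k) + ρ (2 * d k + d i)) % 2
              + (ρ (2 * d k + d i) + ρ (3 * d k)) % 2 then 1 else 0)
      + (if 2 ≤ (ρ (3 * d j) + ρ (2 * d j + d k)) % 2 + (ρ (2 * d j + d k) + ρ (2 * d k + d j)) % 2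
              + (ρ (2 * d k + d j) + ρ (3 * d k)) % 2 then 1 else 0))) :
    ((Matrix.det (∑ l, ((X : ℝ[X]) ^ d l) • (Pᵀ * D l * P).map C)).roots.toFinset.filter (fun t => 0 < t)).card ≤ 18 := by
  have hcongr := SpanRank.posRootCount_congr d D Pᵀ (by rwa [Matrix.det_transpose])
  simp only [Matrix.transpose_transpose] at hcongr
  change posRootCount d (fun l => Pᵀ * D l * P) ≤ 18; rw [show posRootCount d (fun l => Pᵀ * D l * P) = posRootCount d D from hcongr]
  exact card_posRoots_commonEig_le_18 d D m i j k him hjm hkm hij hik hjk hblock hdef ρ hρ hpar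

/-! ## 6. Instances on census supports (the parity test by `decide`) -/

/-- **`(0,1,4,13)`, free letter at `X^0`** (first 3-Sidon support of the `(0,1,4,N)` rail; `m = 0`): three block letters with definite blocks on
`X^1, X^4, X^13` and any letter on `X^0` give at most `18` distinct positive roots. [folklore] -/
theorem card_posRoots_commonEig_le_18_on_0_1_4_13 (S : Fin 4 → Matrix (Fin 3) (Fin 3) ℝ)
    (hblock : ∀ l, l ≠ 0 → S l 0 2 = 0 ∧ S l 1 2 = 0 ∧ S l 2 0 = 0 ∧ S l 2 1 = 0 ∧ S l 1 0 = S l 0 1)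
    (hdef : ∀ l, l ≠ 0 → 0 < S l 0 0 * S l 1 1 - S l 0 1 ^ 2) :
    ((Matrix.det (∑ l, ((X : ℝ[X]) ^ (![0, 1, 4, 13] : Fin 4 → ℕ) l) • (S l).map C)).roots.toFinset.filter (fun t => 0 < t)).card ≤ 18 := by
  have hT : ((Finset.univ : Finset (Fin 4 × Fin 4 × Fin 4)).image
      (fun p => (![0, 1, 4, 13] : Fin 4 → ℕ) p.1 + (![0, 1, 4, 13] : Fin 4 → ℕ) p.2.1 + (![0, 1, 4, 13] : Fin 4 → ℕ) p.2.2))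
        = ({0, 1, 2, 3, 4, 5, 6, 8, 9, 12, 13, 14, 15, 17, 18, 21, 26, 27, 30, 39} : Finset ℕ) := by decide
  refine card_posRoots_commonEig_le_18 _ S 0 1 2 3 (by decide) (by decide) (by decide) (by decide) (by decide) (by decide)
    hblock hdef (fun e => ((({0, 1, 2, 3, 4, 5, 6, 8, 9, 12, 13, 14, 15, 17, 18, 21, 26, 27, 30, 39} : Finset ℕ)).filter (· < e)).card) (fun e => by rw [hT]) ?_
  decide

/-- **`(0,1,7,11)`, free letter at `X^0`** (`m = 0`): at most `18`. [folklore] -/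
theorem card_posRoots_commonEig_le_18_on_0_1_7_11 (S : Fin 4 → Matrix (Fin 3) (Fin 3) ℝ)
    (hblock : ∀ l, l ≠ 0 → S l 0 2 = 0 ∧ S l 1 2 = 0 ∧ S l 2 0 = 0 ∧ S l 2 1 = 0 ∧ S l 1 0 = S l 0 1)
    (hdef : ∀ l, l ≠ 0 → 0 < S l 0 0 * S l 1 1 - S l 0 1 ^ 2) :
    ((Matrix.det (∑ l, ((X : ℝ[X]) ^ (![0, 1, 7, 11] : Fin 4 → ℕ) l) • (S l).map C)).roots.toFinset.filter (fun t => 0 < t)).card ≤ 18 := by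
  have hT : ((Finset.univ : Finset (Fin 4 × Fin 4 × Fin 4)).image
      (fun p => (![0, 1, 7, 11] : Fin 4 → ℕ) p.1 + (![0, 1, 7, 11] : Fin 4 → ℕ) p.2.1 + (![0, 1, 7, 11] : Fin 4 → ℕ) p.2.2))
        = ({0, 1, 2, 3, 7, 8, 9, 11, 12, 13, 14, 15, 18, 19, 21, 22, 23, 25, 29, 33} : Finset ℕ) := by decide
  refine card_posRoots_commonEig_le_18 _ S 0 1 2 3 (by decide) (by decide) (by decide) (by decide) (by decide) (by decide)
    hblock hdef (fun e => ((({0, 1, 2, 3, 7, 8, 9, 11, 12, 13, 14, 15, 18, 19, 21, 22, 23, 25, 29, 33} : Finset ℕ)).filter (· < e)).card) (fun e => by rw [hT]) ?_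
  decide

end Summit.ValiantsHypothesis.ValiantsHypothesis.Theorems.LacunarySymmetroidMatrixDescartes.Census
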